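import Literature.NumberTheory.Automorphic.Liu2021.Def411WeilCarriersSplittingDictionary
import Literature.NumberTheory.Automorphic.UnitaryGroupAdelicOneTorusDictionary
import HarnessLib

/-!
# Characters of the big unitary group of a dual pair: the pair-group adapter for «central characters factor through `det`»

Topic `NumberTheory/Automorphic`; namespace `Literature.NumberTheory.Automorphic.UnitaryGroup`.  KERNEL only: one definition
with body (`adelicPairEquiv`, the tree's `adelicPairEmb` made an equivalence) and proved theorems; no named fact, no `sorry`.

[GelbartRogawski1991, §3.1 Remark p. 457 L9–13]: «If `s*` is any other compatible splitting, then `s* = s ⊗ ν′`, where `ν′` is an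
automorphic character of `E¹`, regarded as a character of `G`».  The tree displays the sentence «regarded as a character of `G`» as
the hypothesis shape `Liu2021.Def411WeilCarriersDoubling.CentralCharFactorsThroughDet F E c N M e J_V J_W hd` on the PAIR group
`G₁(𝔸_F) = U(J_V ⊗ J_W)(𝔸_F)` (`UnitaryGroup.adelicPair`, index `Fin N × Fin M`), and proves the splitting ↦ character dictionary
modulo it (`Def411WeilCarriersSplittingDictionary`).  The group-theoretic input — every continuous character of `U(J)(𝔸_F)` factors
through `det` along a section `sec` — is naturally stated on `UnitaryGroup.adelic F E c n J` (index `Fin n`, the domain of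
`UnitaryGroup.adelicDet`).  This file is the ADAPTER between the two:

* §1 `adelicPairEquiv e : adelicPair F E c N M J_V J_W ≃* adelic F E c n (reindex e e (J_V ⊗ J_W))` (`g ↦ reindex e e g`), continuous
  in both directions, carrying rational points to rational points (`adelicPairEquiv_symm_toAdelic_mem_range`);
* §2 (imported) `UnitaryGroup.norm_apply_eq_one_of_trivial_on_principal` (`UnitaryGroupAdelicOneTorusDictionary` §5, GR-2): a continuous
  character of `U(1)(𝔸_F) = adelicOne F E c` trivial on the principal norm-one ideles is UNITARY (compact quotient, Godement's criterion);
* §3 **`centralCharFactorsThroughDet_of_adelic`** — if every continuous character `χ` of `U(J')(𝔸_F)`, `J' = reindex e e (J_V ⊗ J_W)`,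
  satisfies `χ = (χ ∘ sec) ∘ det` for a continuous section `sec : U(1)(𝔸_F) →* U(J')(𝔸_F)` taking principal norm-one ideles to
  rational points, then `CentralCharFactorsThroughDet F E c N M e J_V J_W hd` holds: continuity by §1, automorphy of `α = χ ∘ sec`
  from the rational triviality of the given character and the rationality of `sec`, unitarity by §2.

References: S. Gelbart, J. Rogawski, Invent. Math. 105 (1991), §3.1 Remark p. 457 L9–13 [GelbartRogawski1991]; R. Godement,
Sém. Bourbaki 257 (1962/63), §5 Thm. 4 [Godement1964]; C. P. Mok, Mem. AMS 235 (2015), §1 p. 5 [Mok2014].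
Provenance: pub-hodgecm2 cell (COR-CM, Hodge ladder stage 2), seat pin-3 (Δ2/X3 co-owner), X3-Char item (A): consumer end of the
kernel chain «characters of `U(3)(𝔸)` factor through `det`» (item6-p3 lineage, `LinearAlgebra/Matrix/GeneralLinearGroupHomDet` &c.).
HC_CM is NOT proved here or anywhere in the tree.
-/

set_option autoImplicit false

noncomputable section

open scoped Matrix Kronecker
open NumberField IsDedekindDomain
open Literature.NumberTheory.GaloisRepresentations

namespace Literature.NumberTheory.Automorphic.UnitaryGroup

section Pair

variable (F E : Type) [Field F] [NumberField F] [Field E] [NumberField E] [Algebra F E]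
variable (c : E ≃ₐ[F] E) (N M : ℕ) {n : ℕ} (e : Fin N × Fin M ≃ Fin n)
variable (JV : Matrix (Fin N) (Fin N) E) (JW : Matrix (Fin M) (Fin M) E)

local notation "𝔸E" => AdeleRing (𝓞 E) E

omit [NumberField F] [NumberField E] in
/-- `reindex e⁻¹ ∘ reindex e = id` on square matrices. [folklore] -/
private theorem reindex_symm_reindex {R : Type*} (e : Fin N × Fin M ≃ Fin n) (X : Matrix (Fin N × Fin M) (Fin N × Fin M) R) :
    Matrix.reindex e.symm e.symm (Matrix.reindex e e X) = X := by
  rw [← Matrix.reindex_symm, Equiv.symm_apply_apply]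

omit [NumberField F] [NumberField E] in
/-- `reindex e ∘ reindex e⁻¹ = id` on square matrices. [folklore] -/
private theorem reindex_reindex_symm {R : Type*} (e : Fin N × Fin M ≃ Fin n) (Y : Matrix (Fin n) (Fin n) R) :
    Matrix.reindex e e (Matrix.reindex e.symm e.symm Y) = Y := by
  rw [← Matrix.reindex_symm, Equiv.apply_symm_apply]

/-! ## §1 `G₁(𝔸_F) = U(J_V ⊗ J_W)(𝔸_F) ≃ U(reindex e e (J_V ⊗ J_W))(𝔸_F)` -/

omit [NumberField F] in
/-- `reindex e⁻¹` carries `U(reindex e e (J_V ⊗ J_W))(𝔸_F)` back into `G₁(𝔸_F)`. [cite: GelbartRogawski1991, §3.2 p. 457] -/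
theorem reindexGL_symm_mem_adelicPair (g : adelic F E c n (Matrix.reindex e e (JV ⊗ₖ JW))) :
    reindexGL e.symm (g : GL (Fin n) 𝔸E) ∈ adelicPair F E c N M JV JW := by
  have h : (g : GL (Fin n) 𝔸E) ∈ unitaryGroupOfForm (conjAdele F E c) (adelicForm E n (Matrix.reindex e e (JV ⊗ₖ JW))) := g.2
  have hre : reindexGL e (reindexGL e.symm (g : GL (Fin n) 𝔸E)) = (g : GL (Fin n) 𝔸E) :=
    Units.ext (reindex_reindex_symm N M e _)
  rw [adelicForm_reindex_kronecker, ← hre, reindexGL_mem_iff] at h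
  exact h

/-- **`adelicPairEquiv e : G₁(𝔸_F) ≃* U(reindex e e (J_V ⊗ J_W))(𝔸_F)`** — the tree's `adelicPairEmb` (`g ↦ reindex e e g`) with its
inverse `g ↦ reindex e⁻¹ e⁻¹ g`. [cite: GelbartRogawski1991, §3.2 p. 457] -/
def adelicPairEquiv : adelicPair F E c N M JV JW ≃* adelic F E c n (Matrix.reindex e e (JV ⊗ₖ JW)) where
  toFun := adelicPairEmb F E c N M e JV JW
  invFun g := ⟨reindexGL e.symm (g : GL (Fin n) 𝔸E), reindexGL_symm_mem_adelicPair F E c N M e JV JW g⟩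
  left_inv _ := Subtype.ext (Units.ext (reindex_symm_reindex N M e _))
  right_inv _ := Subtype.ext (Units.ext (reindex_reindex_symm N M e _))
  map_mul' := map_mul (adelicPairEmb F E c N M e JV JW)

omit [NumberField F] in
/-- `adelicPairEquiv` is `adelicPairEmb` on elements. [cite: GelbartRogawski1991, §3.2 p. 457] -/
@[simp] theorem adelicPairEquiv_apply (g : adelicPair F E c N M JV JW) :
    adelicPairEquiv F E c N M e JV JW g = adelicPairEmb F E c N M e JV JW g := rfl

omit [NumberField F] in
/-- underlying invertible matrix of the inverse: `reindex e⁻¹`. [cite: GelbartRogawski1991, §3.2 p. 457] -/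
@[simp] theorem coe_adelicPairEquiv_symm (g : adelic F E c n (Matrix.reindex e e (JV ⊗ₖ JW))) :
    (((adelicPairEquiv F E c N M e JV JW).symm g : adelicPair F E c N M JV JW) : GL (Fin N × Fin M) 𝔸E) =
      reindexGL e.symm (g : GL (Fin n) 𝔸E) := rfl

omit [NumberField F] in
/-- `adelicPairEquiv` is continuous. [cite: GelbartRogawski1991, §3.2 p. 457] -/
theorem continuous_adelicPairEquiv : Continuous (adelicPairEquiv F E c N M e JV JW) := by
  refine continuous_induced_rng.2 ?_
  change Continuous fun g : adelicPair F E c N M JV JW => ((adelicPairEmb F E c N M e JV JW g : adelic F E c n _) : GL (Fin n) 𝔸E)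
  simp only [coe_adelicPairEmb]
  exact (continuous_reindexGL e).comp continuous_subtype_val

omit [NumberField F] in
/-- the inverse of `adelicPairEquiv` is continuous. [cite: GelbartRogawski1991, §3.2 p. 457] -/
theorem continuous_adelicPairEquiv_symm : Continuous (adelicPairEquiv F E c N M e JV JW).symm := by
  refine continuous_induced_rng.2 ?_
  change Continuous fun g : adelic F E c n (Matrix.reindex e e (JV ⊗ₖ JW)) =>
    (((adelicPairEquiv F E c N M e JV JW).symm g : adelicPair F E c N M JV JW) : GL (Fin N × Fin M) 𝔸E)
  simp only [coe_adelicPairEquiv_symm]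
  exact (continuous_reindexGL e.symm).comp continuous_subtype_val

omit [NumberField F] in
/-- **rational points go to rational points**: the inverse equivalence carries `U(J')(F)` (the range of `toAdelic`) into `G₁(F)`
(the range of `rationalPairToAdelic`) — `reindex e⁻¹` of a rational matrix is rational. [cite: GelbartRogawski1991, §3.2 p. 457] -/
theorem adelicPairEquiv_symm_toAdelic_mem_range (γ' : rational F E c n (Matrix.reindex e e (JV ⊗ₖ JW))) :
    (adelicPairEquiv F E c N M e JV JW).symm (toAdelic F E c n (Matrix.reindex e e (JV ⊗ₖ JW)) γ') ∈
      (rationalPairToAdelic F E c N M JV JW).range := by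
  have hγ : reindexGL e.symm (γ' : GL (Fin n) E) ∈ rationalPair F E c N M JV JW := by
    have h : (γ' : GL (Fin n) E) ∈ unitaryGroupOfForm (c : E →+* E) (Matrix.reindex e e (JV ⊗ₖ JW)) := γ'.2
    have hre : reindexGL e (reindexGL e.symm (γ' : GL (Fin n) E)) = (γ' : GL (Fin n) E) :=
      Units.ext (reindex_reindex_symm N M e _)
    rw [← hre, reindexGL_mem_iff] at h
    exact h
  exact ⟨⟨_, hγ⟩, Subtype.ext (Units.ext rfl)⟩

/-! ## §2 (automorphic characters of `U(1)(𝔸_F)` are unitary: `UnitaryGroup.norm_apply_eq_one_of_trivial_on_principal`,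
`UnitaryGroupAdelicOneTorusDictionary` §5 — imported, not restated) -/

/-! ## §3 The adapter: a `det`-factorisation on `U(J₀)(𝔸_F)`, `J₀ = reindex e e (J_V ⊗ J_W)`, gives `CentralCharFactorsThroughDet` -/

/-- **the pair-group form of «central characters factor through `det`», from the `Fin n`-indexed form.**  Let
`J₀ = reindex e e (J_V ⊗ J_W)` (any term `J₀` with a proof `hJ₀` of this equation — e.g. `J₀ = Matrix.diagonal d` for diagonal
`J_V`, `J_W`, see `reindex_kronecker_diagonal`) with `det J₀ ≠ 0`, and suppose given a continuous section
`sec : U(1)(𝔸_F) →* U(J₀)(𝔸_F)` carrying principal norm-one ideles to rational points, such that EVERY continuous character `χ` of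
`U(J₀)(𝔸_F)` satisfies `χ = (χ ∘ sec) ∘ det` (for `J₀` of rank `3`: the perfectness of `SU(J₀)` at every place — the item6-p3 chain).
Then the displayed hypothesis `CentralCharFactorsThroughDet F E c N M e J_V J_W hd` of `Def411WeilCarriersSplittingDictionary` HOLDS:
for a continuous character `η` of `G₁(𝔸_F)` trivial on `G₁(F)`, `α := (η ∘ (adelicPairEquiv e)⁻¹) ∘ sec` is continuous, automorphic
(rational values of `sec` are killed by `η`), unitary (§2), and `η = α ∘ pairDet`. [cite: GelbartRogawski1991, §3.1 Remark p. 457 L9–13] -/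
theorem centralCharFactorsThroughDet_of_adelic (h2 : Module.finrank F E = 2) (hc : c ≠ 1)
    (hd : (Matrix.reindex e e (JV ⊗ₖ JW)).det ≠ 0) {J₀ : Matrix (Fin n) (Fin n) E}
    (hJ₀ : Matrix.reindex e e (JV ⊗ₖ JW) = J₀) (hd₀ : J₀.det ≠ 0)
    (sec : adelicOne F E c →* adelic F E c n J₀) (hsec : Continuous sec)
    (hsec_rat : ∀ u : adelicOne F E c, (u : ideleGroup E) ∈ principalIdeles E → sec u ∈ (toAdelic F E c n J₀).range)
    (hfac : ∀ χ : adelic F E c n J₀ →* ℂˣ, Continuous χ → χ = (χ.comp sec).comp (adelicDet F E c n J₀ hd₀)) :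
    Liu2021.Def411WeilCarriersDoubling.CentralCharFactorsThroughDet F E c N M e JV JW hd := by
  subst hJ₀
  intro η hηc hηrat
  let χ : adelic F E c n (Matrix.reindex e e (JV ⊗ₖ JW)) →* ℂˣ := η.comp (adelicPairEquiv F E c N M e JV JW).symm.toMonoidHom
  have hχc : Continuous χ := hηc.comp (continuous_adelicPairEquiv_symm F E c N M e JV JW)
  have hχ := hfac χ hχc
  have hαrat : ∀ u : adelicOne F E c, (u : ideleGroup E) ∈ principalIdeles E → (χ.comp sec) u = 1 := by
    intro u hu
    obtain ⟨γ', hγ'⟩ := hsec_rat u hu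
    obtain ⟨γ, hγ⟩ := adelicPairEquiv_symm_toAdelic_mem_range F E c N M e JV JW γ'
    show η ((adelicPairEquiv F E c N M e JV JW).symm (sec u)) = 1
    rw [← hγ', ← hγ]
    exact hηrat _ ⟨γ, rfl⟩
  refine ⟨χ.comp sec, hχc.comp hsec, norm_apply_eq_one_of_trivial_on_principal F E c h2 hc _ (hχc.comp hsec) hαrat, hαrat, ?_⟩
  refine MonoidHom.ext fun g => ?_
  have hηg : η g = χ (adelicPairEquiv F E c N M e JV JW g) := by
    show η g = η ((adelicPairEquiv F E c N M e JV JW).symm (adelicPairEquiv F E c N M e JV JW g))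
    rw [MulEquiv.symm_apply_apply]
  rw [hηg]
  conv_lhs => rw [hχ]
  rfl

/-! ## §4 The diagonal case: `reindex e e (diag d_V ⊗ diag d_W) = diag d` -/

omit [NumberField F] [NumberField E] in
/-- the Gram matrix of `V ⊗ W` for DIAGONAL `J_V = diag d_V`, `J_W = diag d_W` is diagonal after any re-enumeration `e`:
`reindex e e (diag d_V ⊗ₖ diag d_W) = diag (k ↦ d_V (e⁻¹ k).1 · d_W (e⁻¹ k).2)` — the shape `Matrix.diagonal d` on `Fin n` in which
the `Fin n`-indexed factorisation is stated. [cite: GelbartRogawski1991, §3.2 p. 457] -/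
theorem reindex_kronecker_diagonal (dV : Fin N → E) (dW : Fin M → E) :
    Matrix.reindex e e (Matrix.diagonal dV ⊗ₖ Matrix.diagonal dW) =
      Matrix.diagonal fun k => dV (e.symm k).1 * dW (e.symm k).2 := by
  rw [Matrix.diagonal_kronecker_diagonal, Matrix.reindex_apply, Matrix.submatrix_diagonal_equiv]
  rfl

omit [NumberField F] [NumberField E] [Algebra F E] in
/-- a `1 × 1` matrix is diagonal (the hermitian LINE `⟨T_W⟩` of the pin is `diag`). [cite: GelbartRogawski1991, §3.2 p. 457] -/
theorem eq_diagonal_of_fin_one (JW₁ : Matrix (Fin 1) (Fin 1) E) : JW₁ = Matrix.diagonal fun _ => JW₁ 0 0 := by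
  ext i j
  rw [Subsingleton.elim i 0, Subsingleton.elim j 0, Matrix.diagonal_apply_eq]

end Pair

/-! ## §5 CM line datum: the splitting ↦ character dictionary from a `det`-factorisation on `U(J₀)(𝔸_{L⁺})` (one call for the pin) -/

section CMLine

variable (L : Type) [Field L] [NumberField L] [IsCMField L]
variable {N' n' : ℕ} (e₁ : Fin N' × Fin 1 ≃ Fin n')
  (dV₁ : Fin N' → L) (hdV₁ : ∀ i, IsCMField.complexConj L (dV₁ i) = dV₁ i) (hdV₁0 : ∀ i, dV₁ i ≠ 0)

open Literature.NumberTheory.GelbartRogawski1991 Literature.NumberTheory.GelbartRogawski1991.UnitaryDualPair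
open Literature.NumberTheory.GelbartRogawski1991.GRConstruction Literature.NumberTheory.GelbartRogawski1991.GRConstruction.DoubledWeilDetTwist
open Literature.NumberTheory.Automorphic.Liu2021.Def411WeilCarriersDoubling Literature.RepresentationTheory.HarrisKudlaSweet1996
open Literature.NumberTheory.Weil1964 Literature.RepresentationTheory.HeisenbergGroup

include hdV₁0 in
set_option maxHeartbeats 2000000 in
-- (the statement carries the `splittingDatum` telescope of `exists_eq_chiSplittingLine_of_isCompatible`; same budget)
/-- **The dictionary at the CM line datum, ONE CALL**: a `det`-factorisation of the continuous characters of `U(J₀)(𝔸_{L⁺})`,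
`J₀ = reindex e (diag dV ⊗ J_W)`, through a continuous rational section `sec` (the item6-p3 chain at `J₀ = diag d`), a base point `χ₀` of
the dictionary, and a CONTINUOUS compatible splitting `s` of the line datum give `s = ι_{χ₀·α̃}` for a continuous unitary automorphic
`α` — `centralCharFactorsThroughDet_of_adelic` fed into `exists_eq_chiSplittingLine_of_isCompatible` (`[L : L⁺] = 2`, `c̄ ≠ 1` from
`IsCMField`). [cite: GelbartRogawski1991, §3.1 Remark p. 457 L4–13] [cite: Liu2021, App. D §D.1 Step 2 (l. 5219)] -/
theorem exists_eq_chiSplittingLine_of_adelic_factorisation (TW : Matrix (Fin 1) (Fin 1) (Fp L)) (hW : TW.IsSymm)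
    (hWd : IsUnit TW.det) (JW : Matrix (Fin 1) (Fin 1) L) (hJW : JW = TW.map (algebraMap (Fp L) L))
    {J₀ : Matrix (Fin n') (Fin n') L} (hJ₀ : Matrix.reindex e₁ e₁ (Matrix.diagonal dV₁ ⊗ₖ JW) = J₀) (hd₀ : J₀.det ≠ 0)
    (sec : adelicOne (Fp L) L (IsCMField.complexConj L) →* adelic (Fp L) L (IsCMField.complexConj L) n' J₀) (hsec : Continuous sec)
    (hsec_rat : ∀ u : adelicOne (Fp L) L (IsCMField.complexConj L), (u : ideleGroup L) ∈ principalIdeles L →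
      sec u ∈ (toAdelic (Fp L) L (IsCMField.complexConj L) n' J₀).range)
    (hfac : ∀ χ : adelic (Fp L) L (IsCMField.complexConj L) n' J₀ →* ℂˣ, Continuous χ →
      χ = (χ.comp sec).comp (adelicDet (Fp L) L (IsCMField.complexConj L) n' J₀ hd₀))
    (χ₀ : HeckeCharacter L) (hχ₀u : χ₀.IsUnitary) (hχ₀s : IsSplittingChar L 1 χ₀)
    {s : adelicPair (Fp L) L (IsCMField.complexConj L) N' 1 (Matrix.diagonal dV₁) JW →*
      adelicMpCont (Fp L) (Fin n') (adelicGram (Fp L) e₁ (realDiagonal L dV₁ hdV₁) TW)}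
    (hsc : Continuous s)
    (hs : (splittingDatum (Fp L) L (IsCMField.complexConj L) N' 1 e₁ (Matrix.diagonal dV₁) JW
        (complexConj_imagUnit L) (imagUnit_ne_zero L) (imagUnit_mul_self L) (realDiagonal_isSymm L dV₁ hdV₁) hW
        (isUnit_det_realDiagonal L dV₁ hdV₁ hdV₁0) hWd (realDiagonal_map L dV₁ hdV₁).symm hJW).IsCompatible s) :
    ∃ (α : adelicOne (Fp L) L (IsCMField.complexConj L) →* ℂˣ) (hα : Continuous α)
      (hαrat : ∀ u : adelicOne (Fp L) L (IsCMField.complexConj L), (u : ideleGroup L) ∈ principalIdeles L → α u = 1)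
      (hαu : ∀ u, ‖((α u : ℂˣ) : ℂ)‖ = 1),
      s = chiSplittingLine L e₁ dV₁ hdV₁ hdV₁0 (χ₀ * ratioHecke L α hα hαrat) (isUnitary_mul_ratioHecke L hχ₀u hα hαrat hαu)
            ((isSplittingChar_mul_ratioHecke_iff L 1 χ₀ hα hαrat).2 hχ₀s) TW hWd JW hJW :=
  exists_eq_chiSplittingLine_of_isCompatible L e₁ dV₁ hdV₁ hdV₁0 TW hW hWd JW hJW
    (centralCharFactorsThroughDet_of_adelic (Fp L) L (IsCMField.complexConj L) N' 1 e₁ (Matrix.diagonal dV₁) JW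
      (Algebra.IsQuadraticExtension.finrank_eq_two _ L) (IsCMField.complexConj_ne_one (K := L)) _ hJ₀ hd₀ sec hsec hsec_rat hfac)
    χ₀ hχ₀u hχ₀s hsc hs

end CMLine


end Literature.NumberTheory.Automorphic.UnitaryGroup

end
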